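import Summits.QuantumFields.BalabanUV.Beta.CovariantTowerWRS
import Summits.QuantumFields.BalabanUV.Beta.UnitLatticeWalkTerms

/-!
# Beta / CovariantTowerLocalization — U-LOCALISATION OF THE WALK TERMS (O.2 item (iii), second half, in the MODEL):
# every term `walkTerm h (cmat Δ′ − 1) L n b⃗` of the generalized random-walk expansion of the k-fold covariant tower
# inverse depends on the transport U ONLY through the bonds within R_loc = D_k + S_k of the hulls Ω₀(b₀), …, Ω₀(b_n) it
# visits — two transports that agree there give the same term (unit `b2b-balaban-beta-d4-p2`, GEN 5; sixth module of the
# chain; companion of `CovariantTowerRowData`: this is what lets [II] (1.10) attach the s-factors of exactly the cubes a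
# term's localization domain meets)

HONEST FRAMING: discharging `BetaPertH` makes Bałaban's UV stability UNCONDITIONAL — NOT the continuum limit, NOT the
Clay problem.  HONEST DEPENDENCY (verbatim): «continuum YM on T⁴ ⇐ BetaPertH ∧ nine spine estimates (0/9 proved);
BetaPertH ⇐ (D1) ∧ (D4) ∧ CAP+tail; G-an2-4 gates asym, D1 and NE2/3/4.»  THIS MODULE DISCHARGES NOTHING of `BetaPertH`,
asserts NOTHING printed and cites nothing as a fact (ABSOLUTE RULE): [folklore] kernel theorems about the component MODEL
(pv21 `B9Thm37GlueTorusCov*`, model of [B9] = `Balaban1985BackgroundPropagators`, Commun. Math. Phys. 99 (1985) 389–434;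
SHAPES modelled: Thm 3.10 p. 417 «terms … depend on U restricted to …» and [II] = `Balaban1988RG2Cluster` p. 3 / (1.10)
p. 4: a term localized in X̃ is a function of the fields on X̃).

CONTENT.
* §1 `Comb.tr_congr` (a comb transport on the torus depends on the bond matrices within `depth x` of x), `dist_towerBlk_le`,
  `towerTr_congr` (the level-l tower transport at x depends on the bonds within S_l of x).
* §2 `locRadius d M k = D_k + S_k`; **`towerOp_single_congr`**: the column q of Δ′ depends on the bonds within R_loc of q;
  `cmat_towerOp_col_congr`.
* §3 the cube factors (hypothesis: the two transports agree on every bond ending within R_loc of a site of Ω₀(b)): `sandwich_congr`, **`LTorus_congr`**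
  (the Dirichlet local inverse), `commPj_congr`, **`headFactor_congr`**, **`stepFactor_congr`**, and the END
  **`walkTerm_congr`**: agreement near Ω₀(b₀), …, Ω₀(b_n) ⇒ equal walk terms.
NOT HERE / NOT CLAIMED: anything about Bałaban's operators; print's localization domains X̃⁵; the s-factors themselves
(`CovariantTowerRowData`).  Row D4: RECORDS value (O.2 item (iii) complete in the MODEL: ℓ²/resolvent form gen 4, walk
indexing gen 4, WRS/RowData currency and U-localisation gen 5); class of (T3)/NODE O.2 unchanged; D4 DISCHARGE NO DATE;
NOT BetaPertH, NOT continuum, NOT Clay.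
-/

namespace Summit.QuantumFields.BalabanUV.Beta.CovariantTowerLocalization

open Finset
open Literature.MathematicalPhysics.QuantumFieldTheory.Balaban1983to89
open B9Thm37Sum B9Thm37Glue B9Thm37GluePU B9Thm37GlueTorusInv B9Thm37GlueTorusCov B9Thm37GlueTorusCovComp
open B9Thm37GlueTorusCovPoinc (tdepth_le card_block_le)
open B9Thm37GlueTorusCovLevels B9Thm37GlueTorusCovTower B9Thm37GlueTorusCovTowerDir
open B9Thm37GlueTorusCovTowerPU (omegaBall omegaBall_zero_or_one omegaBall_eq_one)
open B9Thm37GlueTorusCovCT (abs_sub_dist_le)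
open Summit.QuantumFields.BalabanUV.Beta.CovariantTowerDecay (towerS towerS_zero towerS_succ abs_sub_towerBlk_le)
open Summit.QuantumFields.BalabanUV.Beta.CovariantTowerDecayTorus (towerS_mono)
open Summit.QuantumFields.BalabanUV.Beta.CovariantTowerMatrix
open Summit.QuantumFields.BalabanUV.Beta.CovariantTowerLocal
open Summit.QuantumFields.BalabanUV.Beta.CovariantTowerWRS
open Summit.QuantumFields.BalabanUV.Beta.UnitLatticeWalkInversion (Hd Pj)
open Summit.QuantumFields.BalabanUV.Beta.UnitLatticeWalkTerms (headFactor stepFactor walkTerm)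
open B5TorusCover (UT Ctr ctrU)
open B5Leibniz121 (up dist_up_le)

noncomputable section

variable {d : ℕ} {N : Fin d → ℕ} [∀ i, NeZero (N i)] [NeZero d]

/-! ## §1  Transports depend on nearby bonds only -/

section Transports

variable {Cp : Type} [Fintype Cp] [DecidableEq Cp] {B : Type}

omit [NeZero d] in
/-- **A comb transport on the torus depends only on the bond matrices within `depth x` of x**: if two transports agree on
every bond ending within torus distance `depth x` of x, their holonomies to the base point agree (induction along the
parent chain; each parent bond has length ≤ 1). [folklore] -/
theorem Comb.tr_congr (K : Comb (bsrc (N := N)) (btgt (N := N)) B) (Rm Rm' : UT N × Fin d → Cp → Cp → ℝ) :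
    ∀ (n : ℕ) (x : UT N), K.depth x = n →
      (∀ β : UT N × Fin d, dist x (btgt β) ≤ n → Rm β = Rm' β) → K.tr Rm x = K.tr Rm' x := by
  intro n
  induction n with
  | zero =>
      intro x hx _
      funext i j
      rw [K.tr_of_depth_eq_zero Rm hx, K.tr_of_depth_eq_zero Rm' hx]
  | succ n ih =>
      intro x hx hagree
      have hx0 : K.depth x ≠ 0 := by omega
      have hp : K.depth (K.parent x) = n := by have := K.depth_parent x hx0; omega
      have hdp : dist x (K.parent x) ≤ 1 := by
        have h1 : dist (bsrc (K.pbond x)) (btgt (K.pbond x)) ≤ 1 := dist_bsrc_btgt_le (K.pbond x)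
        rw [K.src_pbond x hx0, K.tgt_pbond x hx0] at h1
        rwa [dist_comm] at h1
      have hpar : K.tr Rm (K.parent x) = K.tr Rm' (K.parent x) := by
        refine ih _ hp fun β hβ => hagree β ?_
        calc dist x (btgt β) ≤ dist x (K.parent x) + dist (K.parent x) (btgt β) := dist_triangle _ _ _
          _ ≤ 1 + n := add_le_add hdp hβ
          _ = (n + 1 : ℕ) := by push_cast; ring
      have hbond : Rm (K.pbond x) = Rm' (K.pbond x) := by
        refine hagree _ ?_
        rw [K.tgt_pbond x hx0, dist_self]; positivity
      funext i j
      rw [K.tr_of_depth_ne_zero Rm hx0, K.tr_of_depth_ne_zero Rm' hx0, hpar, hbond]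

/-- **x is within S_l of its level-l representative.** [folklore] -/
theorem dist_towerBlk_le {M : ℕ → ℕ} (hM : ∀ j, 1 ≤ M j) (hdiv : ∀ j i, M j ∣ N i) (l : ℕ) (x : UT N) :
    dist x (towerBlk (torusTower hM hdiv) l x) ≤ (towerS (fun j => d * (M j - 1)) l : ℝ) := by
  have h := abs_sub_towerBlk_le (torusTower hM hdiv) (fun y => (1 : ℝ) * dist x y) zero_le_one
    (fun b => abs_sub_dist_le x zero_le_one b) (D := fun j => d * (M j - 1)) (fun j y => tdepth_le (hM j) y) l x
  simp only [dist_self, mul_zero, zero_sub, abs_neg, one_mul, mul_one] at h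
  rwa [abs_of_nonneg dist_nonneg] at h

/-- **The level-l tower transport at x depends only on the bond matrices within S_l of x.** [folklore] -/
theorem towerTr_congr {M : ℕ → ℕ} (hM : ∀ j, 1 ≤ M j) (hdiv : ∀ j i, M j ∣ N i)
    (Rm Rm' : UT N × Fin d → Cp → Cp → ℝ) :
    ∀ (l : ℕ) (x : UT N), (∀ β : UT N × Fin d, dist x (btgt β) ≤ (towerS (fun j => d * (M j - 1)) l : ℝ) → Rm β = Rm' β) →
      towerTr (torusTower hM hdiv) Rm l x = towerTr (torusTower hM hdiv) Rm' l x := by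
  intro l
  induction l with
  | zero => intro x _; funext i j; rw [towerTr_zero, towerTr_zero]
  | succ l ih =>
      intro x hagree
      set y := towerBlk (torusTower hM hdiv) l x with hy
      have hS : (towerS (fun j => d * (M j - 1)) (l + 1) : ℝ) =
          (towerS (fun j => d * (M j - 1)) l : ℝ) + (d * (M l - 1) : ℕ) := by
        rw [towerS_succ]; push_cast; ring
      have hxy : dist x y ≤ (towerS (fun j => d * (M j - 1)) l : ℝ) := dist_towerBlk_le hM hdiv l x
      have h1 : towerTr (torusTower hM hdiv) Rm l x = towerTr (torusTower hM hdiv) Rm' l x :=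
        ih x fun β hβ => hagree β (hβ.trans (by rw [hS]; exact le_add_of_nonneg_right (Nat.cast_nonneg _)))
      have h2 : (torusTower hM hdiv l).tr Rm y = (torusTower hM hdiv l).tr Rm' y := by
        refine Comb.tr_congr (torusTower hM hdiv l) Rm Rm' _ y rfl fun β hβ => hagree β ?_
        have hdepth : ((torusTower hM hdiv l).depth y : ℝ) ≤ (d * (M l - 1) : ℕ) := by
          exact_mod_cast tdepth_le (hM l) y
        calc dist x (btgt β) ≤ dist x y + dist y (btgt β) := dist_triangle _ _ _
          _ ≤ (towerS (fun j => d * (M j - 1)) l : ℝ) + (d * (M l - 1) : ℕ) := add_le_add hxy (hβ.trans hdepth)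
          _ = (towerS (fun j => d * (M j - 1)) (l + 1) : ℝ) := hS.symm
      funext i j
      rw [towerTr_succ, towerTr_succ, mmul_apply, mmul_apply, ← hy, h1, h2]

end Transports

/-! ## §2  A column of the tower operator depends on nearby bonds only -/

section Column

variable {Cp : Type} [Fintype Cp] [DecidableEq Cp]

/-- MODEL bookkeeping: **the localization radius** R_loc = D_k + S_k. [folklore] -/
def locRadius (d : ℕ) (M : ℕ → ℕ) (k : ℕ) : ℝ := rangeTower d M k + (towerS (fun j => d * (M j - 1)) k : ℝ)

/-- **THE COLUMN q OF Δ′ DEPENDS ONLY ON THE BONDS WITHIN R_loc OF q**: if two isometric-or-not transports agree on every bond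
ending within D_k + S_k of the site of q, then Δ′_U(δ_q) = Δ′_{U′}(δ_q) (∇_U\*∇_U: bonds at q and at the output site, ≤ D_k
away; level terms: the tower transports at q and at the output site, bonds ≤ S_l beyond). [folklore] -/
theorem towerOp_single_congr {M : ℕ → ℕ} (hM : ∀ j, 1 ≤ M j) (hdiv : ∀ j i, M j ∣ N i) (c : UT N × Fin d → ℝ)
    (Rm Rm' : UT N × Fin d → Cp → Cp → ℝ) (k : ℕ) (W : Fin (k + 1) → UT N → ℝ) (a : Fin (k + 1) → ℝ)
    (q : UT N × Cp) (hagree : ∀ β : UT N × Fin d, dist q.1 (btgt β) ≤ locRadius d M k → Rm β = Rm' β) (r : ℝ)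
    (p : UT N × Cp) :
    towerOp (torusTower hM hdiv) Rm c k W a (Pi.single q r) p =
      towerOp (torusTower hM hdiv) Rm' c k W a (Pi.single q r) p := by
  by_cases hfar : rangeTower d M k < dist p.1 q.1
  · rw [towerOp_single_eq_zero_of_far hM hdiv c Rm k W a p q r hfar,
      towerOp_single_eq_zero_of_far hM hdiv c Rm' k W a p q r hfar]
  have hpq : dist p.1 q.1 ≤ rangeTower d M k := not_lt.mp hfar
  have hS0 : 0 ≤ (towerS (fun j => d * (M j - 1)) k : ℝ) := Nat.cast_nonneg _
  have hD0 := rangeTower_nonneg d M k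
  set f : UT N × Cp → ℝ := Pi.single q r with hf
  have hfy : ∀ y j, y ≠ q.1 → f (y, j) = 0 := fun y j hy => by
    rw [hf, Pi.single_apply, if_neg]; exact fun h => hy (congrArg Prod.fst h)
  -- ∇_U f is the same for both transports (only bonds ending at q see a transport)
  have hD : covD bsrc btgt c Rm f = covD bsrc btgt c Rm' f := by
    funext β'
    obtain ⟨β, i⟩ := β'
    rw [covD_apply, covD_apply]
    by_cases hβ : btgt β = q.1
    · rw [hagree β (by rw [hβ, dist_self]; exact add_nonneg hD0 hS0)]
    · simp only [hfy _ _ hβ, mul_zero, Finset.sum_const_zero]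
  have hDT : covDT bsrc btgt c Rm (covD bsrc btgt c Rm f) p = covDT bsrc btgt c Rm' (covD bsrc btgt c Rm' f) p := by
    rw [← hD, covDT_apply, covDT_apply]
    refine Finset.sum_congr rfl fun β _ => ?_
    by_cases hβ : btgt β = p.1
    · rw [hagree β ?_]
      rw [hβ, dist_comm]
      exact hpq.trans (le_add_of_nonneg_right hS0)
    · simp only [hβ, if_false, zero_mul]
  -- the tower transports at q and at p agree
  have hTq : ∀ l : Fin (k + 1), towerTr (torusTower hM hdiv) Rm (l : ℕ) q.1 = towerTr (torusTower hM hdiv) Rm' (l : ℕ) q.1 :=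
    fun l => towerTr_congr hM hdiv Rm Rm' (l : ℕ) q.1 fun β hβ => hagree β (by
      have := towerS_mono (fun j => d * (M j - 1)) (Nat.lt_succ_iff.mp l.2)
      have h' : (towerS (fun j => d * (M j - 1)) (l : ℕ) : ℝ) ≤ towerS (fun j => d * (M j - 1)) k := by exact_mod_cast this
      unfold locRadius; linarith)
  have hTp : ∀ l : Fin (k + 1), towerTr (torusTower hM hdiv) Rm (l : ℕ) p.1 = towerTr (torusTower hM hdiv) Rm' (l : ℕ) p.1 :=
    fun l => towerTr_congr hM hdiv Rm Rm' (l : ℕ) p.1 fun β hβ => hagree β (by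
      have := towerS_mono (fun j => d * (M j - 1)) (Nat.lt_succ_iff.mp l.2)
      have h' : (towerS (fun j => d * (M j - 1)) (l : ℕ) : ℝ) ≤ towerS (fun j => d * (M j - 1)) k := by exact_mod_cast this
      unfold locRadius
      calc dist q.1 (btgt β) ≤ dist q.1 p.1 + dist p.1 (btgt β) := dist_triangle _ _ _
        _ ≤ rangeTower d M k + towerS (fun j => d * (M j - 1)) k := by rw [dist_comm]; linarith)
  have hG : ∀ (l : Fin (k + 1)) (β : UT N) (i : Cp),
      gMean (towerBlk (torusTower hM hdiv) (l : ℕ)) (W l) (towerTr (torusTower hM hdiv) Rm (l : ℕ)) f (β, i) =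
        gMean (towerBlk (torusTower hM hdiv) (l : ℕ)) (W l) (towerTr (torusTower hM hdiv) Rm' (l : ℕ)) f (β, i) := by
    intro l β i
    rw [gMean_apply, gMean_apply]
    refine Finset.sum_congr rfl fun y _ => ?_
    by_cases hy : y = q.1
    · subst hy; rw [hTq l]
    · simp only [hfy y _ hy, mul_zero, Finset.sum_const_zero, ite_self]
  have hL : levelSum (fun l : Fin (k + 1) => towerBlk (torusTower hM hdiv) (l : ℕ)) W
        (fun l => towerTr (torusTower hM hdiv) Rm (l : ℕ)) a f p =
      levelSum (fun l : Fin (k + 1) => towerBlk (torusTower hM hdiv) (l : ℕ)) W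
        (fun l => towerTr (torusTower hM hdiv) Rm' (l : ℕ)) a f p := by
    rw [levelSum_apply, levelSum_apply]
    refine Finset.sum_congr rfl fun l _ => ?_
    rw [gMeanT_apply, gMeanT_apply, hTp l]
    simp only [hG l]
  show (covDT bsrc btgt c Rm ∘ₗ covD bsrc btgt c Rm +
      levelSum (fun l : Fin (k + 1) => towerBlk (torusTower hM hdiv) (l : ℕ)) W
        (fun l => towerTr (torusTower hM hdiv) Rm (l : ℕ)) a) f p =
    (covDT bsrc btgt c Rm' ∘ₗ covD bsrc btgt c Rm' +
      levelSum (fun l : Fin (k + 1) => towerBlk (torusTower hM hdiv) (l : ℕ)) W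
        (fun l => towerTr (torusTower hM hdiv) Rm' (l : ℕ)) a) f p
  rw [LinearMap.add_apply, LinearMap.add_apply, Pi.add_apply, Pi.add_apply, LinearMap.comp_apply,
    LinearMap.comp_apply, hDT, hL]

/-- **… in the matrix currency**: the column q of `cmat Δ′` depends only on the bonds within R_loc of q. [folklore] -/
theorem cmat_towerOpT_col_congr {M : ℕ → ℕ} (hM : ∀ j, 1 ≤ M j) (hdiv : ∀ j i, M j ∣ N i) (c : UT N × Fin d → ℝ)
    (Rm Rm' : UT N × Fin d → Cp → Cp → ℝ) (k : ℕ) (w : Fin (k + 1) → UT N → ℝ) (a : Fin (k + 1) → ℝ)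
    (q : UT N × Cp) (hagree : ∀ β : UT N × Fin d, dist q.1 (btgt β) ≤ locRadius d M k → Rm β = Rm' β)
    (p : UT N × Cp) : cmat (towerOpT hM hdiv c Rm k w a) p q = cmat (towerOpT hM hdiv c Rm' k w a) p q := by
  rw [cmat_apply, cmat_apply, towerOpT, towerOpT, towerOp_single_congr hM hdiv c Rm Rm' k _ a q hagree 1 p]

end Column

/-! ## §3  The cube factors and the walk terms -/

section Factors

variable {Cp : Type} [Fintype Cp] [DecidableEq Cp]

/-- **Ω₀ Δ′ Ω₀ depends only on the bonds near Ω₀** (columns inside Ω₀ agree; columns outside are killed). [folklore] -/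
theorem sandwich_congr {M : ℕ → ℕ} (hM : ∀ j, 1 ≤ M j) (hdiv : ∀ j i, M j ∣ N i) (c : UT N × Fin d → ℝ)
    (Rm Rm' : UT N × Fin d → Cp → Cp → ℝ) (k : ℕ) (w : Fin (k + 1) → UT N → ℝ) (a : Fin (k + 1) → ℝ) (M₀ : ℕ)
    (z : Ctr N M₀) (hag : ∀ (x : UT N) (β : UT N × Fin d), omegaBall hM hdiv k M₀ z x = 1 →
      dist x (btgt β) ≤ locRadius d M k → Rm β = Rm' β) :
    mulOp (omegaBall hM hdiv k M₀ z ∘ Prod.fst) * towerOpT hM hdiv c Rm k w a * mulOp (omegaBall hM hdiv k M₀ z ∘ Prod.fst) =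
      mulOp (omegaBall hM hdiv k M₀ z ∘ Prod.fst) * towerOpT hM hdiv c Rm' k w a *
        mulOp (omegaBall hM hdiv k M₀ z ∘ Prod.fst) := by
  apply LinearMap.ext
  intro v
  funext p
  simp only [Module.End.mul_apply, mulOp_apply, Function.comp_apply]
  congr 1
  rw [apply_eq_sum_single (towerOpT hM hdiv c Rm k w a), apply_eq_sum_single (towerOpT hM hdiv c Rm' k w a)]
  refine Finset.sum_congr rfl fun q _ => ?_
  simp only [mulOp_apply, Function.comp_apply]
  rcases omegaBall_zero_or_one hM hdiv k M₀ z q.1 with h0 | h1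
  · rw [h0, zero_mul, mul_zero, mul_zero]
  · rw [towerOpT, towerOpT, towerOp_single_congr hM hdiv c Rm Rm' k _ a q (fun β hβ => hag q.1 β h1 hβ) 1 p]

/-- **THE DIRICHLET LOCAL INVERSE G′_z DEPENDS ONLY ON THE BONDS NEAR Ω₀(z)** (it is a function of Ω₀Δ′Ω₀). [folklore] -/
theorem LTorus_congr {M : ℕ → ℕ} (hM : ∀ j, 1 ≤ M j) (hdiv : ∀ j i, M j ∣ N i) (c : UT N × Fin d → ℝ)
    (Rm Rm' : UT N × Fin d → Cp → Cp → ℝ) (k : ℕ) (w : Fin (k + 1) → UT N → ℝ) (a : Fin (k + 1) → ℝ) (M₀ : ℕ)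
    (z : Ctr N M₀) (hag : ∀ (x : UT N) (β : UT N × Fin d), omegaBall hM hdiv k M₀ z x = 1 →
      dist x (btgt β) ≤ locRadius d M k → Rm β = Rm' β) :
    LTorus hM hdiv c Rm k w a M₀ z = LTorus hM hdiv c Rm' k w a M₀ z := by
  rw [LTorus, LTorus, dirInv, dirInv, sandwich_congr hM hdiv c Rm Rm' k w a M₀ z hag]

/-- **The commutator columns inside Ω₀(z) depend only on the bonds near Ω₀(z)**: `(H_zK′ − K′H_z)·P_z` agrees for the two
transports (K′ = cmat Δ′ − 1). [folklore] -/
theorem commPj_congr {M : ℕ → ℕ} (hM : ∀ j, 1 ≤ M j) (hdiv : ∀ j i, M j ∣ N i) (c : UT N × Fin d → ℝ)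
    (Rm Rm' : UT N × Fin d → Cp → Cp → ℝ) (k : ℕ) (w : Fin (k + 1) → UT N → ℝ) (a : Fin (k + 1) → ℝ) (M₀ : ℕ)
    (z : Ctr N M₀) (hag : ∀ (x : UT N) (β : UT N × Fin d), omegaBall hM hdiv k M₀ z x = 1 →
      dist x (btgt β) ≤ locRadius d M k → Rm β = Rm' β) :
    (Hd (hTorus N Cp M₀) z * (cmat (towerOpT hM hdiv c Rm k w a) - 1) -
        (cmat (towerOpT hM hdiv c Rm k w a) - 1) * Hd (hTorus N Cp M₀) z) * Pj (ETorus hM hdiv k M₀ Cp) z =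
      (Hd (hTorus N Cp M₀) z * (cmat (towerOpT hM hdiv c Rm' k w a) - 1) -
        (cmat (towerOpT hM hdiv c Rm' k w a) - 1) * Hd (hTorus N Cp M₀) z) * Pj (ETorus hM hdiv k M₀ Cp) z := by
  ext p q
  simp only [Matrix.mul_apply, Pj, Matrix.diagonal_apply, mul_ite, mul_one, mul_zero, Finset.sum_ite_eq',
    Finset.mem_univ, if_true]
  by_cases hq : q ∈ ETorus hM hdiv k M₀ Cp z
  · rw [if_pos hq, if_pos hq]
    have hq1 := (mem_ETorus hM hdiv k M₀ z q).1 hq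
    have hcol : ∀ p', cmat (towerOpT hM hdiv c Rm k w a) p' q = cmat (towerOpT hM hdiv c Rm' k w a) p' q :=
      fun p' => cmat_towerOpT_col_congr hM hdiv c Rm Rm' k w a q (fun β hβ => hag q.1 β hq1 hβ) p'
    simp only [Matrix.sub_apply, Matrix.mul_apply, Hd, Matrix.diagonal_apply, ite_mul, zero_mul, mul_ite, mul_zero,
      Finset.sum_ite_eq, Finset.sum_ite_eq', Finset.mem_univ, if_true, hcol]
  · rw [if_neg hq, if_neg hq]

/-- **The head factor H_zG′_zH_z depends only on the bonds near Ω₀(z).** [folklore] -/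
theorem headFactor_congr {M : ℕ → ℕ} (hM : ∀ j, 1 ≤ M j) (hdiv : ∀ j i, M j ∣ N i) (c : UT N × Fin d → ℝ)
    (Rm Rm' : UT N × Fin d → Cp → Cp → ℝ) (k : ℕ) (w : Fin (k + 1) → UT N → ℝ) (a : Fin (k + 1) → ℝ) (M₀ : ℕ)
    (z : Ctr N M₀) (hag : ∀ (x : UT N) (β : UT N × Fin d), omegaBall hM hdiv k M₀ z x = 1 →
      dist x (btgt β) ≤ locRadius d M k → Rm β = Rm' β) :
    headFactor (hTorus N Cp M₀) (LTorus hM hdiv c Rm k w a M₀) z =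
      headFactor (hTorus N Cp M₀) (LTorus hM hdiv c Rm' k w a M₀) z := by
  rw [headFactor, headFactor, LTorus_congr hM hdiv c Rm Rm' k w a M₀ z hag]

/-- **The step factor (H_zK′ − K′H_z)G′_zH_z depends only on the bonds near Ω₀(z)** (insert P_z in front of G′_z = P_zG′_z).
[folklore] -/
theorem stepFactor_congr {M : ℕ → ℕ} (hM : ∀ j, 1 ≤ M j) (hdiv : ∀ j i, M j ∣ N i) (c : UT N × Fin d → ℝ)
    (Rm Rm' : UT N × Fin d → Cp → Cp → ℝ) (k : ℕ) (w : Fin (k + 1) → UT N → ℝ) (a : Fin (k + 1) → ℝ) (M₀ : ℕ)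
    (z : Ctr N M₀) (hag : ∀ (x : UT N) (β : UT N × Fin d), omegaBall hM hdiv k M₀ z x = 1 →
      dist x (btgt β) ≤ locRadius d M k → Rm β = Rm' β) :
    stepFactor (hTorus N Cp M₀) (cmat (towerOpT hM hdiv c Rm k w a) - 1) (LTorus hM hdiv c Rm k w a M₀) z =
      stepFactor (hTorus N Cp M₀) (cmat (towerOpT hM hdiv c Rm' k w a) - 1) (LTorus hM hdiv c Rm' k w a M₀) z := by
  rw [stepFactor, stepFactor, ← Pj_mul_LTorus hM hdiv c Rm k w a M₀ z, ← Pj_mul_LTorus hM hdiv c Rm' k w a M₀ z,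
    ← LTorus_congr hM hdiv c Rm Rm' k w a M₀ z hag]
  simp only [← Matrix.mul_assoc]
  rw [commPj_congr hM hdiv c Rm Rm' k w a M₀ z hag]

/-- **U-LOCALISATION OF THE WALK TERMS (MODEL of [B9] Thm 3.10 / [II] (1.10)'s «localized in X̃»)**: if two transports agree
on every bond within R_loc = D_k + S_k of the hulls Ω₀(b₀), …, Ω₀(b_n) of a cube sequence, the corresponding terms of the
generalized random-walk expansion of Δ′⁻¹ coincide — for every torus and all weights; no isometry needed. [folklore] -/
theorem walkTerm_congr {M : ℕ → ℕ} (hM : ∀ j, 1 ≤ M j) (hdiv : ∀ j i, M j ∣ N i) (c : UT N × Fin d → ℝ)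
    (Rm Rm' : UT N × Fin d → Cp → Cp → ℝ) (k : ℕ) (w : Fin (k + 1) → UT N → ℝ) (a : Fin (k + 1) → ℝ) (M₀ : ℕ) :
    ∀ (n : ℕ) (bs : Fin (n + 1) → Ctr N M₀),
      (∀ (t : Fin (n + 1)) (x : UT N) (β : UT N × Fin d), omegaBall hM hdiv k M₀ (bs t) x = 1 →
        dist x (btgt β) ≤ locRadius d M k → Rm β = Rm' β) →
      walkTerm (hTorus N Cp M₀) (cmat (towerOpT hM hdiv c Rm k w a) - 1) (LTorus hM hdiv c Rm k w a M₀) n bs =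
        walkTerm (hTorus N Cp M₀) (cmat (towerOpT hM hdiv c Rm' k w a) - 1) (LTorus hM hdiv c Rm' k w a M₀) n bs := by
  intro n
  induction n with
  | zero =>
      intro bs hag
      show headFactor _ _ (bs 0) = headFactor _ _ (bs 0)
      exact headFactor_congr hM hdiv c Rm Rm' k w a M₀ (bs 0) (hag 0)
  | succ n ih =>
      intro bs hag
      show walkTerm _ _ _ n (Fin.init bs) * stepFactor _ _ _ (bs (Fin.last (n + 1))) =
        walkTerm _ _ _ n (Fin.init bs) * stepFactor _ _ _ (bs (Fin.last (n + 1)))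
      rw [ih (Fin.init bs) (fun t => hag _), stepFactor_congr hM hdiv c Rm Rm' k w a M₀ _ (hag _)]

end Factors

end

end Summit.QuantumFields.BalabanUV.Beta.CovariantTowerLocalization
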